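import Mathlib
import HarnessLib.Audit
import Summits.PneNP.PneNP.Theorems.PstarChordBridgeAssemble
import Summits.PneNP.PneNP.Theorems.PstarChordBridgeKill

/-!
# Bridge data from raw terminal data, with all side conditions of the regime theorems (ROUND-24, memo §9 R0–R1; GAPTWO-PLAN S4)

FRONTIER range-avoidance ladder, rung F-N3, ROUND 24 (cell `pnp-ideate`, planner memo `r24/CORE-BOUND-NOTES.md` §9 ("PROOF ARCHITECTURE FOR
CoreBound … best attacked through the strong form `CoreBoundAt`"); restricted-model proof complexity — nothing here bears on `P` versus `NP`).

Packaging.  The chain `PstarChordBridge*` / `PstarNorUnit*` speaks about BRIDGE DATA `B`; the rung's hypothesis `PstarGapTwoAssembly.CoreBoundAt`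
speaks about a terminal core `(y, J₀, 𝒲)`.  `bridge_of_terminal` builds, from the raw terminal data plus the chain's three standing assumptions,
bridge data satisfying EVERY side condition the regime theorems consume:

* raw data: pure typed `(r,3/2)`-expanding instance with simple overlaps; targets `y`; a non-empty XOR-closed core `J₀`; two G-constraints
  `w₁, w₂` with monomials off `J₀`; (T3) `J₀ ∧ w₁ ∧ w₂` unsolvable; (M0) solvable after deleting any output of `J₀`;
* standing assumptions (memo O1/O2): a maximal leaf-peelable `F ⊆ J₀` all of whose co-edges are chords (ASSUMPTION A), and no monomial of
  `w₁, w₂` touching a private AND variable of a co-edge (privates unread — which contains "no CROSS pendant");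
* output: `B` with `B.J₀ = J₀`, `B.N = J₀ ∖ F ≠ ∅`, the constraints of `w₁, w₂`, `B.WF I`, `Lift I B`, `Peelable I (J₀ ∖ N)`, pendants off the
  core and off the privates, pairwise killable chords (`PstarChordBridgeKill.killable_pair`), and (T3)/(M0) in `Solution` form.

The regime theorems (`PstarChordBridgeKill.regime_cases`, prover-1's `PstarNorUnitEQ1.regime_trichotomy` / announced `regime_dichotomy`) and
`PstarChordBridgeCornerUnit.card_eq_three_of_corner` then apply verbatim; the end-to-end corollary on raw data is `PstarChordBridgeFive`.
-/

set_option linter.dupNamespace false -- `Summit.PneNP.PneNP.…`: summit = sub-problem name (D-0017 single-conjunct layout)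

open Finset Module Literature.Computability.Complexity
open Summit.PneNP.PneNP.Theorems.PstarTyped (Typed)
open Summit.PneNP.PneNP.Theorems.PstarSALevel (varSet bdry BoundaryExpanding SimpleOverlap)
open Summit.PneNP.PneNP.Theorems.PstarGapOneAll (gval)
open Summit.PneNP.PneNP.Theorems.PstarCoreBound (XorClosed)
open Summit.PneNP.PneNP.Theorems.PstarChordRepair (IsChord)
open Summit.PneNP.PneNP.Theorems.PstarChordSystem (ChordSystem)
open Summit.PneNP.PneNP.Theorems.PstarChordBridgeTools
open Summit.PneNP.PneNP.Theorems.PstarChordBridge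
open Summit.PneNP.PneNP.Theorems.PstarChordBridgeCotree (Peelable sdiff_nonempty_of_xorClosed)
open Summit.PneNP.PneNP.Theorems.PstarChordBridgeTerminal (HasConstraints)
open Summit.PneNP.PneNP.Theorems.PstarChordBridgeAssemble (exists_bridgeData)
open Summit.PneNP.PneNP.Theorems.PstarChordBridgeKill (killable_pair)

namespace Summit.PneNP.PneNP.Theorems.PstarChordBridgeTerminalData

variable {n m : ℕ}

/-- **Bridge data for a terminal core, with every side condition of the regime theorems.**  See the module docstring. -/
theorem bridge_of_terminal (I : LocalMap 4 n m) (hI : I.IsPure xorAndPred) (hT : Typed I) (hS : SimpleOverlap I) {r : ℕ}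
    (hB : BoundaryExpanding r I) (y : Fin m → Bool) {J₀ : Finset (Fin m)} (hne : J₀.Nonempty) (hX : XorClosed I J₀) (hr : J₀.card ≤ r)
    (w₁ w₂ : Finset (Fin n) × Finset (Fin m) × Bool) (hG₁ : Disjoint J₀ w₁.2.1) (hG₂ : Disjoint J₀ w₂.2.1)
    (hT3 : ¬ ∃ z : Fin n → Bool, (∀ j ∈ J₀, I.eval z j = y j) ∧ gval I w₁.1 w₁.2.1 z = w₁.2.2 ∧ gval I w₂.1 w₂.2.1 z = w₂.2.2)
    (hM0 : ∀ f ∈ J₀, ∃ z : Fin n → Bool, (∀ j ∈ J₀.erase f, I.eval z j = y j) ∧ gval I w₁.1 w₁.2.1 z = w₁.2.2 ∧ gval I w₂.1 w₂.2.1 z = w₂.2.2)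
    {F : Finset (Fin m)} (hF : F ⊆ J₀) (hP : Peelable I F) (hmax : ∀ F', F ⊆ F' → F' ⊆ J₀ → Peelable I F' → F' = F)
    (hchord : ∀ e ∈ J₀ \ F, IsChord I J₀ e)
    (hun : ∀ g ∈ w₁.2.1 ∪ w₂.2.1, ∀ v ∈ privs I (J₀ \ F), I.vars g 2 ≠ v ∧ I.vars g 3 ≠ v) :
    ∃ B : BridgeData n m, B.y = y ∧ B.J₀ = J₀ ∧ B.N = J₀ \ F ∧ HasConstraints B w₁ w₂ ∧ B.WF I ∧ Lift I B ∧
      Peelable I (B.J₀ \ B.N) ∧ Disjoint B.G₁ B.J₀ ∧ Disjoint B.G₂ B.J₀ ∧ B.N.Nonempty ∧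
      (∀ v ∈ privs I B.N, (∀ g ∈ B.G₁, I.vars g 2 ≠ v ∧ I.vars g 3 ≠ v) ∧ ∀ g ∈ B.G₂, I.vars g 2 ≠ v ∧ I.vars g 3 ≠ v) ∧
      (∀ e ∈ B.N, ∀ e' ∈ B.N, e ≠ e' → ∃ a, (sys I B).u e a = 0 ∧ (sys I B).u e' a = 0) ∧
      (¬ ∃ z, Solution I B B.J₀ z) ∧ (∀ f ∈ B.J₀, ∃ z, Solution I B (B.J₀.erase f) z) := by
  classical
  have hcross : ∀ g ∈ w₁.2.1 ∪ w₂.2.1, ¬ (I.vars g 2 ∈ privs I (J₀ \ F) ∧ I.vars g 3 ∈ privs I (J₀ \ F)) :=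
    fun g hg h => (hun g hg _ h.1).1 rfl
  obtain ⟨B, hy, hJ, hN, hC, hW, hL, -, -⟩ :=
    exists_bridgeData I hI hT hS hB y hne hr w₁ w₂ hG₁ hG₂ hT3 hM0 hF hP hmax hchord hcross
  obtain ⟨h1, h2, h3, h4, h5, h6⟩ := hC
  have hsol : ∀ K z, Solution I B K z ↔
      (∀ j ∈ K, I.eval z j = y j) ∧ gval I w₁.1 w₁.2.1 z = w₁.2.2 ∧ gval I w₂.1 w₂.2.1 z = w₂.2.2 := by
    intro K z
    unfold Solution
    rw [hy, h1, h2, h3, h4, h5, h6]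
  refine ⟨B, hy, hJ, hN, ⟨h1, h2, h3, h4, h5, h6⟩, hW, hL, ?_, ?_, ?_, ?_, ?_, ?_, ?_, ?_⟩
  · rw [hJ, hN, Finset.sdiff_sdiff_eq_self hF]; exact hP
  · rw [h2, hJ]; exact hG₁.symm
  · rw [h5, hJ]; exact hG₂.symm
  · rw [hN]; exact sdiff_nonempty_of_xorClosed I hT hX hne hF hP
  · intro v hv
    rw [hN] at hv
    rw [h2, h5]
    exact ⟨fun g hg => hun g (mem_union_left _ hg) v hv, fun g hg => hun g (mem_union_right _ hg) v hv⟩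
  · have hJr : B.J₀.card ≤ r := by rw [hJ]; exact hr
    exact killable_pair I hI hS hB hW hJr
  · rw [hJ]
    rintro ⟨z, hz⟩
    exact hT3 ⟨z, (hsol J₀ z).1 hz⟩
  · rw [hJ]
    intro f hf
    obtain ⟨z, hz⟩ := hM0 f hf
    exact ⟨z, (hsol _ z).2 hz⟩

end Summit.PneNP.PneNP.Theorems.PstarChordBridgeTerminalData
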